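import Mathlib
import Literature.Computability.AlgebraicComplexity.RealTauKnownCases
import Summits.ValiantsHypothesis.ValiantsHypothesis.Theorems.LacunarySymmetroidMatrixDescartesGramDual
import Summits.ValiantsHypothesis.ValiantsHypothesis.Theorems.LacunarySymmetroidMatrixDescartesGramDualSplitting
import Summits.ValiantsHypothesis.ValiantsHypothesis.Theorems.LacunarySymmetroidMatrixDescartesGramDualFrame

/-!
# `MatrixDescartes` (stmt-ValiantsHypothesis-18050) — Gram duality, part 4: ARBITRARY LETTERS against one
# non-degenerate BASE letter (signed column systems; no semidefiniteness anywhere)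

HONEST FRAMING.  Cell `pub-symmetroid`, seat `val-sym-mdr-p2` (gen 19); helper file `--supports` the crux
`Theses.LacunarySymmetroid.MatrixDescartes` (OPEN), NO closure claim; companion of `…GramDual`, `…GramDualSplitting`,
`…GramDualFrame` (the PSD-letter case).  A structure theorem for EVERY lacunary pencil having ONE non-degenerate
letter; nothing here bears on the crux in its window, on `stub_twoSided`, `DoorA26` / `DoorA34`, registers, or
`VP ≠ VNP`.

THE SIGNED COLUMN FORM.  Every real symmetric letter is a signed sum of rank-one terms, `S = Σⱼ σⱼ uⱼuⱼᵀ`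
(spectral theorem; `σⱼ = ±λ`), so every lacunary symmetric pencil with a distinguished letter `B = S_{l₀}` at
exponent `e` reads `X^e B + U · diag(σⱼ X^{δⱼ}) · Uᵀ` with a real `ι × ρ` matrix `U` (all eigen-columns of the other
letters), real SIGNS/WEIGHTS `σⱼ ≠ 0` and column exponents `δⱼ`.  No semidefiniteness is assumed, and `B` need
only be NON-DEGENERATE (`det B ≠ 0`; not even symmetric).

**THEOREM (`X_pow_mul_det_base`, Gram duality with signs).**  For `e, δⱼ ≤ E`:

  `X^{E·R} · det (X^e B + U diag(σ X^δ) Uᵀ) = C(det B · ∏σⱼ) · X^{e·m + Σδ} · det (diag(σⱼ⁻¹ X^{E−δⱼ}) + X^{E−e}·UᵀB⁻¹U)`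

(`m = card ι`, `R = card ρ`).  Hence (`posRoots_base_eq`) the pencil has exactly the positive zeros of the DUAL
PENCIL `diag(σⱼ⁻¹X^{E−δⱼ}) + X^{E−e}·C` of size `R` — signed coordinate-projector letters plus ONE constant letter,
the `B⁻¹`-GRAM MATRIX `C = UᵀB⁻¹U` of the columns: the letters of a lacunary pencil interact with a non-degenerate
base letter ONLY through the Gram matrix of their eigen-columns in the (indefinite) metric `B⁻¹`.
CONSEQUENCES (all sizes, all exponents, all signs):
* `card_posRoots_base_split_le` — **SPLITTING LAW for arbitrary letters**: two column groups with `B⁻¹`-ORTHOGONAL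
  ranges (`U₂ᵀB⁻¹U₁ = 0`) are ADDITIVE in `Z₊`;
* `posRoots_base_eq_empty_of_gram_eq_zero` — a `B⁻¹`-NULL column system carries no positive zero;
* (companion `…GramDualSignedFrame`) the FRAME LAW `Z₊ ≤ #{j : σⱼ·(uⱼᵀB⁻¹uⱼ) < 0}` for pairwise
  `B⁻¹`-orthogonal columns and «signed rank-one words of any size are `κ × κ` pencils».

PROOF: as in `…GramDual` (scaled Sylvester `GramDual.sylvester_scaled`), with the signed diagonal
`D = diag(σⱼx^{δⱼ})`, `diag(σⱼ⁻¹x^{E−δⱼ})·D = x^E·1`, `det D = (∏σⱼ)·x^{Σδ}`. [folklore] (Sylvester's determinant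
identity; the lacunary-pencil reading is this seat's.)  Axioms `propext`, `Classical.choice`, `Quot.sound`.
-/

-- layout Summits/ValiantsHypothesis/ValiantsHypothesis forces the duplicated namespace component
set_option linter.dupNamespace false

namespace Summit.ValiantsHypothesis.ValiantsHypothesis.Theorems.LacunarySymmetroidMatrixDescartes

open Polynomial Matrix Finset
open scoped BigOperators

namespace GramDual

variable {ι ρ ρ₁ ρ₂ κ : Type*} [Fintype ι] [DecidableEq ι] [Fintype ρ] [DecidableEq ρ]
  [Fintype ρ₁] [DecidableEq ρ₁] [Fintype ρ₂] [DecidableEq ρ₂] [Fintype κ] [DecidableEq κ]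

/-- the signed column part `U · diag(σⱼ X^{δⱼ}) · Uᵀ` (file-local notation) -/
local notation3 (prettyPrint := false) "𝕊[" U ", " σ ", " δ "]" =>
  ((U : Matrix _ _ ℝ).map Polynomial.C
      * Matrix.diagonal (fun j => Polynomial.C ((σ : _ → ℝ) j) * (Polynomial.X : Polynomial ℝ) ^ (δ j : ℕ))
      * ((U : Matrix _ _ ℝ).map Polynomial.C)ᵀ)

/-- the signed primal word `X^e • B + U · diag(σⱼ X^{δⱼ}) · Uᵀ` (file-local notation) -/
local notation3 (prettyPrint := false) "𝔽ₛ[" e ", " B ", " U ", " σ ", " δ "]" =>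
  (((Polynomial.X : Polynomial ℝ) ^ (e : ℕ)) • (B : Matrix _ _ ℝ).map Polynomial.C + 𝕊[U, σ, δ])

/-- the signed dual word `diag(σⱼ⁻¹ X^{E−δⱼ}) + X^{E−e} • (UᵀB⁻¹U)` (file-local notation) -/
local notation3 (prettyPrint := false) "𝔻ₛ[" E ", " e ", " B ", " U ", " σ ", " δ "]" =>
  (Matrix.diagonal (fun j => Polynomial.C (((σ : _ → ℝ) j)⁻¹) * (Polynomial.X : Polynomial ℝ) ^ ((E : ℕ) - δ j))
    + ((Polynomial.X : Polynomial ℝ) ^ ((E : ℕ) - (e : ℕ))) •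
      ((U : Matrix _ _ ℝ)ᵀ * (B : Matrix _ _ ℝ)⁻¹ * (U : Matrix _ _ ℝ)).map Polynomial.C)

/-! ## §1  The pointwise identity with signs -/

/-- **Pointwise signed Gram duality** (`x ≠ 0`, all `σⱼ ≠ 0`):
`x^{ER}·det(x^eB + U D Uᵀ) = det B·(∏σ)·x^{em+Σδ}·det(diag(σ⁻¹x^{E−δ}) + x^{E−e}UᵀB⁻¹U)`, `D = diag(σⱼx^{δⱼ})`.
[folklore] -/
theorem det_base_mul_eq (B : Matrix ι ι ℝ) (hB : IsUnit B.det) (U : Matrix ι ρ ℝ) (σ : ρ → ℝ) (hσ : ∀ j, σ j ≠ 0)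
    (e E : ℕ) (δ : ρ → ℕ) (he : e ≤ E) (hδ : ∀ j, δ j ≤ E) {x : ℝ} (hx : x ≠ 0) :
    x ^ (E * Fintype.card ρ) * (x ^ e • B + U * Matrix.diagonal (fun j => σ j * x ^ δ j) * Uᵀ).det
      = B.det * (∏ j, σ j) * x ^ (e * Fintype.card ι + ∑ j, δ j) *
        (Matrix.diagonal (fun j => (σ j)⁻¹ * x ^ (E - δ j)) + x ^ (E - e) • (Uᵀ * B⁻¹ * U)).det := by
  set D : Matrix ρ ρ ℝ := Matrix.diagonal (fun j => σ j * x ^ δ j) with hD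
  set Dh : Matrix ρ ρ ℝ := Matrix.diagonal (fun j => (σ j)⁻¹ * x ^ (E - δ j)) with hDh
  set C : Matrix ρ ρ ℝ := Uᵀ * B⁻¹ * U with hC
  have ha : x ^ e • B + U * D * Uᵀ = B * (x ^ e • (1 : Matrix ι ι ℝ) + (B⁻¹ * U * D) * Uᵀ) := by
    rw [Matrix.mul_add, Matrix.mul_smul, Matrix.mul_one]
    simp only [← Matrix.mul_assoc]
    rw [Matrix.mul_nonsing_inv _ hB, Matrix.one_mul]
  have hb : (x ^ e) ^ Fintype.card ρ * (x ^ e • (1 : Matrix ι ι ℝ) + (B⁻¹ * U * D) * Uᵀ).det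
      = (x ^ e) ^ Fintype.card ι * (x ^ e • (1 : Matrix ρ ρ ℝ) + C * D).det := by
    rw [sylvester_scaled (B⁻¹ * U * D) Uᵀ (pow_ne_zero _ hx), hC]
    simp only [Matrix.mul_assoc]
  have hDD : Dh * D = x ^ E • (1 : Matrix ρ ρ ℝ) := by
    rw [hDh, hD, Matrix.diagonal_mul_diagonal, ← Matrix.diagonal_one, ← Matrix.diagonal_smul]
    congr 1
    funext j
    rw [Pi.smul_apply, smul_eq_mul, mul_one, mul_mul_mul_comm, inv_mul_cancel₀ (hσ j), one_mul, ← pow_add,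
      Nat.sub_add_cancel (hδ j)]
  have hc : (Dh + x ^ (E - e) • C) * D = x ^ (E - e) • (x ^ e • (1 : Matrix ρ ρ ℝ) + C * D) := by
    rw [Matrix.add_mul, Matrix.smul_mul, hDD, smul_add, smul_smul, ← pow_add, Nat.sub_add_cancel he]
  have hc' : (Dh + x ^ (E - e) • C).det * D.det
      = (x ^ (E - e)) ^ Fintype.card ρ * (x ^ e • (1 : Matrix ρ ρ ℝ) + C * D).det := by
    rw [← Matrix.det_mul, hc, Matrix.det_smul]
  have hd : D.det = (∏ j, σ j) * x ^ (∑ j, δ j) := by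
    rw [hD, Matrix.det_diagonal, Finset.prod_mul_distrib, Finset.prod_pow_eq_pow_sum]
  have hpow1 : x ^ (E * Fintype.card ρ) = (x ^ (E - e)) ^ Fintype.card ρ * (x ^ e) ^ Fintype.card ρ := by
    rw [← mul_pow, ← pow_add, Nat.sub_add_cancel he, pow_mul]
  have hpow2 : x ^ (e * Fintype.card ι + ∑ j, δ j) = (x ^ e) ^ Fintype.card ι * x ^ (∑ j, δ j) := by
    rw [pow_add, pow_mul]
  rw [ha, Matrix.det_mul, hpow1, hpow2]
  linear_combination ((x ^ (E - e)) ^ Fintype.card ρ * B.det) * hb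
    - (B.det * (x ^ e) ^ Fintype.card ι) * hc'
    + (B.det * (x ^ e) ^ Fintype.card ι * (Dh + x ^ (E - e) • C).det) * hd

/-! ## §2  The identity in `ℝ[X]` and the positive zeros -/

/-- Evaluating the signed primal word. -/
theorem eval_base (B : Matrix ι ι ℝ) (U : Matrix ι ρ ℝ) (σ : ρ → ℝ) (e : ℕ) (δ : ρ → ℕ) (x : ℝ) :
    (Polynomial.evalRingHom x).mapMatrix (𝔽ₛ[e, B, U, σ, δ])
      = x ^ e • B + U * Matrix.diagonal (fun j => σ j * x ^ δ j) * Uᵀ := by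
  classical
  ext i k
  simp only [RingHom.mapMatrix_apply, Matrix.map_apply, Matrix.add_apply, Matrix.smul_apply, smul_eq_mul,
    Polynomial.coe_evalRingHom, Polynomial.eval_add, Polynomial.eval_mul, Polynomial.eval_pow,
    Polynomial.eval_X, Polynomial.eval_C, Matrix.mul_apply, Matrix.diagonal_apply, Matrix.transpose_apply,
    Polynomial.eval_finsetSum, mul_ite, mul_zero, Finset.sum_ite_eq', Finset.mem_univ, if_true]

/-- Evaluating the signed dual word. -/
theorem eval_baseDual (B : Matrix ι ι ℝ) (U : Matrix ι ρ ℝ) (σ : ρ → ℝ) (E e : ℕ) (δ : ρ → ℕ) (x : ℝ) :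
    (Polynomial.evalRingHom x).mapMatrix (𝔻ₛ[E, e, B, U, σ, δ])
      = Matrix.diagonal (fun j => (σ j)⁻¹ * x ^ (E - δ j)) + x ^ (E - e) • (Uᵀ * B⁻¹ * U) := by
  ext i k
  simp only [RingHom.mapMatrix_apply, Matrix.map_apply, Matrix.add_apply, Matrix.smul_apply, smul_eq_mul,
    Polynomial.coe_evalRingHom, Polynomial.eval_add, Polynomial.eval_mul, Polynomial.eval_pow,
    Polynomial.eval_X, Polynomial.eval_C, Matrix.diagonal_apply, apply_ite (Polynomial.eval x),
    Polynomial.eval_zero]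

/-- `det` of the signed primal word, evaluated. -/
theorem eval_det_base (B : Matrix ι ι ℝ) (U : Matrix ι ρ ℝ) (σ : ρ → ℝ) (e : ℕ) (δ : ρ → ℕ) (x : ℝ) :
    (Matrix.det (𝔽ₛ[e, B, U, σ, δ])).eval x
      = (x ^ e • B + U * Matrix.diagonal (fun j => σ j * x ^ δ j) * Uᵀ).det := by
  classical
  have h := RingHom.map_det (Polynomial.evalRingHom x) (𝔽ₛ[e, B, U, σ, δ])
  rw [Polynomial.coe_evalRingHom] at h
  rw [h, eval_base]

/-- `det` of the signed dual word, evaluated. -/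
theorem eval_det_baseDual (B : Matrix ι ι ℝ) (U : Matrix ι ρ ℝ) (σ : ρ → ℝ) (E e : ℕ) (δ : ρ → ℕ) (x : ℝ) :
    (Matrix.det (𝔻ₛ[E, e, B, U, σ, δ])).eval x
      = (Matrix.diagonal (fun j => (σ j)⁻¹ * x ^ (E - δ j)) + x ^ (E - e) • (Uᵀ * B⁻¹ * U)).det := by
  have h := RingHom.map_det (Polynomial.evalRingHom x) (𝔻ₛ[E, e, B, U, σ, δ])
  rw [Polynomial.coe_evalRingHom] at h
  rw [h, eval_baseDual]

/-- **GRAM DUALITY WITH SIGNS (polynomial identity).**  `det B ≠ 0`, all `σⱼ ≠ 0`, `e, δⱼ ≤ E`: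
`X^{E·card ρ}·det(X^eB + U diag(σX^δ) Uᵀ) = C(det B·∏σ)·X^{e·card ι + Σδ}·det(diag(σ⁻¹X^{E−δ}) + X^{E−e}·UᵀB⁻¹U)`.
[folklore] -/
theorem X_pow_mul_det_base (B : Matrix ι ι ℝ) (hB : IsUnit B.det) (U : Matrix ι ρ ℝ) (σ : ρ → ℝ)
    (hσ : ∀ j, σ j ≠ 0) (e E : ℕ) (δ : ρ → ℕ) (he : e ≤ E) (hδ : ∀ j, δ j ≤ E) :
    (Polynomial.X : Polynomial ℝ) ^ (E * Fintype.card ρ) * Matrix.det (𝔽ₛ[e, B, U, σ, δ])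
      = Polynomial.C (B.det * ∏ j, σ j) * (Polynomial.X : Polynomial ℝ) ^ (e * Fintype.card ι + ∑ j, δ j)
          * Matrix.det (𝔻ₛ[E, e, B, U, σ, δ]) := by
  apply Polynomial.eq_of_infinite_eval_eq
  refine Set.Infinite.mono (s := {x : ℝ | x ≠ 0}) (fun x hx => ?_)
    ((Set.finite_singleton (0 : ℝ)).infinite_compl.mono fun x hx => by
      simpa [Set.mem_compl_iff, Set.mem_singleton_iff] using hx)
  simp only [Set.mem_setOf_eq] at hx ⊢
  rw [Polynomial.eval_mul, Polynomial.eval_pow, Polynomial.eval_X, eval_det_base, Polynomial.eval_mul,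
    Polynomial.eval_mul, Polynomial.eval_C, Polynomial.eval_pow, Polynomial.eval_X, eval_det_baseDual]
  exact det_base_mul_eq B hB U σ hσ e E δ he hδ hx

/-- The two signed determinants vanish identically together. [folklore] -/
theorem det_base_eq_zero_iff (B : Matrix ι ι ℝ) (hB : IsUnit B.det) (U : Matrix ι ρ ℝ) (σ : ρ → ℝ)
    (hσ : ∀ j, σ j ≠ 0) (e E : ℕ) (δ : ρ → ℕ) (he : e ≤ E) (hδ : ∀ j, δ j ≤ E) :
    Matrix.det (𝔽ₛ[e, B, U, σ, δ]) = 0 ↔ Matrix.det (𝔻ₛ[E, e, B, U, σ, δ]) = 0 := by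
  have h := X_pow_mul_det_base B hB U σ hσ e E δ he hδ
  have hX : ∀ n : ℕ, (Polynomial.X : Polynomial ℝ) ^ n ≠ 0 := fun n => pow_ne_zero _ Polynomial.X_ne_zero
  have hc : Polynomial.C (B.det * ∏ j, σ j) ≠ 0 := by
    rw [Ne, Polynomial.C_eq_zero]
    exact mul_ne_zero hB.ne_zero (Finset.prod_ne_zero_iff.2 fun j _ => hσ j)
  constructor
  · intro h0
    rw [h0, mul_zero] at h
    rcases mul_eq_zero.1 h.symm with h1 | h1
    · rcases mul_eq_zero.1 h1 with h2 | h2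
      · exact absurd h2 hc
      · exact absurd h2 (hX _)
    · exact h1
  · intro h0
    rw [h0, mul_zero] at h
    rcases mul_eq_zero.1 h with h1 | h1
    · exact absurd h1 (hX _)
    · exact h1

/-- Same vanishing at every non-zero scale. [folklore] -/
theorem eval_det_base_eq_zero_iff (B : Matrix ι ι ℝ) (hB : IsUnit B.det) (U : Matrix ι ρ ℝ) (σ : ρ → ℝ)
    (hσ : ∀ j, σ j ≠ 0) (e E : ℕ) (δ : ρ → ℕ) (he : e ≤ E) (hδ : ∀ j, δ j ≤ E) {x : ℝ} (hx : x ≠ 0) :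
    (Matrix.det (𝔽ₛ[e, B, U, σ, δ])).eval x = 0 ↔ (Matrix.det (𝔻ₛ[E, e, B, U, σ, δ])).eval x = 0 := by
  have h := det_base_mul_eq B hB U σ hσ e E δ he hδ hx
  rw [eval_det_base, eval_det_baseDual]
  have h1 : x ^ (E * Fintype.card ρ) ≠ 0 := pow_ne_zero _ hx
  have h2 : B.det * (∏ j, σ j) * x ^ (e * Fintype.card ι + ∑ j, δ j) ≠ 0 :=
    mul_ne_zero (mul_ne_zero hB.ne_zero (Finset.prod_ne_zero_iff.2 fun j _ => hσ j)) (pow_ne_zero _ hx)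
  constructor
  · intro h0
    rw [h0, mul_zero] at h
    exact (mul_eq_zero.1 h.symm).resolve_left h2
  · intro h0
    rw [h0, mul_zero] at h
    exact (mul_eq_zero.1 h).resolve_left h1

/-- **The positive zeros of the signed word and its dual coincide.** [folklore] -/
theorem posRoots_base_eq (B : Matrix ι ι ℝ) (hB : IsUnit B.det) (U : Matrix ι ρ ℝ) (σ : ρ → ℝ)
    (hσ : ∀ j, σ j ≠ 0) (e E : ℕ) (δ : ρ → ℕ) (he : e ≤ E) (hδ : ∀ j, δ j ≤ E) :
    (Matrix.det (𝔽ₛ[e, B, U, σ, δ])).roots.toFinset.filter (fun t => 0 < t)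
      = (Matrix.det (𝔻ₛ[E, e, B, U, σ, δ])).roots.toFinset.filter (fun t => 0 < t) := by
  ext t
  simp only [Finset.mem_filter, Multiset.mem_toFinset, Polynomial.mem_roots', Polynomial.IsRoot.def]
  constructor
  · rintro ⟨⟨hne, hev⟩, ht⟩
    exact ⟨⟨fun h0 => hne ((det_base_eq_zero_iff B hB U σ hσ e E δ he hδ).2 h0),
      (eval_det_base_eq_zero_iff B hB U σ hσ e E δ he hδ ht.ne').1 hev⟩, ht⟩
  · rintro ⟨⟨hne, hev⟩, ht⟩
    exact ⟨⟨fun h0 => hne ((det_base_eq_zero_iff B hB U σ hσ e E δ he hδ).1 h0),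
      (eval_det_base_eq_zero_iff B hB U σ hσ e E δ he hδ ht.ne').2 hev⟩, ht⟩

omit [DecidableEq ρ] in
/-- A common exponent bound (bookkeeping). -/
theorem exists_bound (e : ℕ) (δ : ρ → ℕ) : ∃ E : ℕ, e ≤ E ∧ ∀ j, δ j ≤ E := by
  classical
  refine ⟨e + ∑ j, δ j, Nat.le_add_right _ _, fun j => ?_⟩
  exact (Finset.single_le_sum (f := δ) (fun i _ => Nat.zero_le _) (Finset.mem_univ j)).trans
    (Nat.le_add_left _ _)

/-- **`B⁻¹`-NULL signed column systems carry no positive zero.** [folklore] -/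
theorem posRoots_base_eq_empty_of_gram_eq_zero (B : Matrix ι ι ℝ) (hB : IsUnit B.det) (U : Matrix ι ρ ℝ)
    (σ : ρ → ℝ) (hσ : ∀ j, σ j ≠ 0) (e : ℕ) (δ : ρ → ℕ) (hC : Uᵀ * B⁻¹ * U = 0) :
    (Matrix.det (𝔽ₛ[e, B, U, σ, δ])).roots.toFinset.filter (fun t => 0 < t) = ∅ := by
  classical
  obtain ⟨E, he, hδ⟩ := exists_bound e δ
  rw [posRoots_base_eq B hB U σ hσ e E δ he hδ, Finset.filter_eq_empty_iff]
  intro t ht hpos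
  rw [Multiset.mem_toFinset, Polynomial.mem_roots', Polynomial.IsRoot.def, eval_det_baseDual] at ht
  obtain ⟨-, hev⟩ := ht
  rw [hC, smul_zero, add_zero, Matrix.det_diagonal] at hev
  exact absurd hev (Finset.prod_ne_zero_iff.2 fun j _ => mul_ne_zero (inv_ne_zero (hσ j)) (pow_ne_zero _ hpos.ne'))

/-! ## §3  Splitting law for arbitrary letters -/

omit [Fintype ι] [DecidableEq ι] in
/-- Juxtaposition of signed column systems = sum. [folklore] -/
theorem signedPart_fromCols (U₁ : Matrix ι ρ₁ ℝ) (U₂ : Matrix ι ρ₂ ℝ) (σ₁ : ρ₁ → ℝ) (σ₂ : ρ₂ → ℝ)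
    (δ₁ : ρ₁ → ℕ) (δ₂ : ρ₂ → ℕ) :
    𝕊[Matrix.fromCols U₁ U₂, Sum.elim σ₁ σ₂, Sum.elim δ₁ δ₂] = 𝕊[U₁, σ₁, δ₁] + 𝕊[U₂, σ₂, δ₂] := by
  have hdiag : Matrix.diagonal (fun j : ρ₁ ⊕ ρ₂ =>
        Polynomial.C (Sum.elim σ₁ σ₂ j) * (Polynomial.X : Polynomial ℝ) ^ (Sum.elim δ₁ δ₂ j))
      = Matrix.fromBlocks
          (Matrix.diagonal fun j => Polynomial.C (σ₁ j) * (Polynomial.X : Polynomial ℝ) ^ δ₁ j) 0 0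
          (Matrix.diagonal fun j => Polynomial.C (σ₂ j) * (Polynomial.X : Polynomial ℝ) ^ δ₂ j) := by
    rw [Matrix.fromBlocks_diagonal]
    congr 1
    funext j
    cases j <;> rfl
  rw [Matrix.fromCols_map, Matrix.transpose_fromCols, hdiag, Matrix.fromCols_mul_fromBlocks,
    Matrix.fromCols_mul_fromRows]
  simp only [Matrix.mul_zero, add_zero, zero_add]

omit [Fintype ρ₁] [Fintype ρ₂] in
/-- The signed dual of a juxtaposition in block form. [folklore] -/
theorem baseDual_fromCols (E e : ℕ) (B : Matrix ι ι ℝ) (U₁ : Matrix ι ρ₁ ℝ) (U₂ : Matrix ι ρ₂ ℝ)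
    (σ₁ : ρ₁ → ℝ) (σ₂ : ρ₂ → ℝ) (δ₁ : ρ₁ → ℕ) (δ₂ : ρ₂ → ℕ) :
    𝔻ₛ[E, e, B, Matrix.fromCols U₁ U₂, Sum.elim σ₁ σ₂, Sum.elim δ₁ δ₂]
      = Matrix.fromBlocks (𝔻ₛ[E, e, B, U₁, σ₁, δ₁])
          (((Polynomial.X : Polynomial ℝ) ^ (E - e)) • (U₁ᵀ * B⁻¹ * U₂).map Polynomial.C)
          (((Polynomial.X : Polynomial ℝ) ^ (E - e)) • (U₂ᵀ * B⁻¹ * U₁).map Polynomial.C)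
          (𝔻ₛ[E, e, B, U₂, σ₂, δ₂]) := by
  have hdiag : Matrix.diagonal (fun j : ρ₁ ⊕ ρ₂ =>
        Polynomial.C ((Sum.elim σ₁ σ₂ j)⁻¹) * (Polynomial.X : Polynomial ℝ) ^ (E - Sum.elim δ₁ δ₂ j))
      = Matrix.fromBlocks
          (Matrix.diagonal fun j => Polynomial.C ((σ₁ j)⁻¹) * (Polynomial.X : Polynomial ℝ) ^ (E - δ₁ j)) 0 0
          (Matrix.diagonal fun j => Polynomial.C ((σ₂ j)⁻¹) * (Polynomial.X : Polynomial ℝ) ^ (E - δ₂ j)) := by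
    rw [Matrix.fromBlocks_diagonal]
    congr 1
    funext j
    cases j <;> rfl
  rw [gram_fromCols, hdiag, Matrix.fromBlocks_map, Matrix.fromBlocks_smul, Matrix.fromBlocks_add]
  simp only [zero_add]

/-- **SPLITTING LAW FOR ARBITRARY LETTERS.**  `det B ≠ 0`, all signs non-zero; if the two column groups have
`B⁻¹`-ORTHOGONAL ranges (`U₂ᵀB⁻¹U₁ = 0`) then
`Z₊(X^eB + U₁diag(σ₁X^{δ₁})U₁ᵀ + U₂diag(σ₂X^{δ₂})U₂ᵀ) ≤ Z₊(X^eB + U₁…U₁ᵀ) + Z₊(X^eB + U₂…U₂ᵀ)`.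
No semidefiniteness, no symmetry of `B`. [folklore] -/
theorem card_posRoots_base_split_le (B : Matrix ι ι ℝ) (hB : IsUnit B.det) (U₁ : Matrix ι ρ₁ ℝ)
    (U₂ : Matrix ι ρ₂ ℝ) (σ₁ : ρ₁ → ℝ) (σ₂ : ρ₂ → ℝ) (hσ₁ : ∀ j, σ₁ j ≠ 0) (hσ₂ : ∀ j, σ₂ j ≠ 0) (e : ℕ)
    (δ₁ : ρ₁ → ℕ) (δ₂ : ρ₂ → ℕ) (horth : U₂ᵀ * B⁻¹ * U₁ = 0) :
    ((Matrix.det (((Polynomial.X : Polynomial ℝ) ^ e) • B.map Polynomial.C + 𝕊[U₁, σ₁, δ₁] + 𝕊[U₂, σ₂, δ₂])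
        ).roots.toFinset.filter (fun t => 0 < t)).card
      ≤ ((Matrix.det (𝔽ₛ[e, B, U₁, σ₁, δ₁])).roots.toFinset.filter (fun t => 0 < t)).card
        + ((Matrix.det (𝔽ₛ[e, B, U₂, σ₂, δ₂])).roots.toFinset.filter (fun t => 0 < t)).card := by
  classical
  obtain ⟨E, he, hδ⟩ := exists_bound e (Sum.elim δ₁ δ₂)
  have hδ₁ : ∀ j, δ₁ j ≤ E := fun j => hδ (Sum.inl j)
  have hδ₂ : ∀ j, δ₂ j ≤ E := fun j => hδ (Sum.inr j)
  have hσ : ∀ j, Sum.elim σ₁ σ₂ j ≠ 0 := fun j => by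
    cases j with
    | inl j => exact hσ₁ j
    | inr j => exact hσ₂ j
  rw [add_assoc, ← signedPart_fromCols, posRoots_base_eq B hB _ _ hσ e E _ he hδ,
    posRoots_base_eq B hB U₁ σ₁ hσ₁ e E δ₁ he hδ₁, posRoots_base_eq B hB U₂ σ₂ hσ₂ e E δ₂ he hδ₂,
    baseDual_fromCols, horth, Matrix.map_zero _ (map_zero _), smul_zero, Matrix.det_fromBlocks_zero₂₁]
  exact card_posRoots_mul_le _ _

end GramDual

end Summit.ValiantsHypothesis.ValiantsHypothesis.Theorems.LacunarySymmetroidMatrixDescartes
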